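/- Free-seat work of EXTRA WIDTH SEAT `ym-line-cbag-p1-w4` (prover-ym-line-cbag-p1-w4-g2-0), route `EguchiKawaiDirectionLadder`
(ideator ym-idea-2, LINE 8), crux `TripleSmallBallMargin` (stmt-QuantumFields-27724), skeleton v6, stub (a♯)/(b♯): sub-stub W2b of
the planner's STUB-PLAN (evidence #12) — «cluster Haar absorption + compression defect into the rank-robust R».  ROUTE-INDEPENDENT,
index-generic (a block of a labelling is a subtype `{i // c i = a}`).  Nothing here bears on the Yang–Mills mass gap. -/
import Summits.QuantumFields.YangMills.Theorems.EguchiKawaiDirectionLadderCompressionSplit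
import HarnessLib

/-!
# Route `EguchiKawaiDirectionLadder`: robust pair-event transfer through a compression (W2b-core)

In the block factorisation `U_μ = W_μ · ι(V_μ)` (`…BlockDiagonalDefs`, `…HaarAbsorption`) the compressed links of a block `a` are
`(U_μ)_{aa} = M_μ · V_{μ,a}` with `V_{μ,a}` independent Haar unitaries of the block and `M_μ = (W_μ)_{aa} = Θ_μ + R_μ + S_μ`
(polar unitary + rank `≤ q_μ` + Frobenius `≤ ε_μ`, `…CompressionSplit`).  This file shows that the ROBUST PAIR EVENT
«`[M₁V₁, M₂V₂]` is within Frobenius² `s` of a matrix of rank `≤ k`» is carried, up to the defects, into the same event for a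
HAAR PAIR `(P₁, P₂) = (Θ₁V₁, Θ₂V₂)`:

* (ALG) `commutator_transfer_split`: `[M₁V₁, M₂V₂] = [Θ₁V₁, Θ₂V₂] + R′ + S′`, `rank R′ ≤ 2(q₁ + q₂)`,
  `Σ|S′|² ≤ 12(ε₁² + ε₂² + ε₁²ε₂²)` — for ANY unitaries `V₁, V₂`;
* (MEAS) `measurePreserving_unitary_mul_prod`: `(V₁,V₂) ↦ (Θ₁V₁, Θ₂V₂)` preserves `Haar ⊗ Haar` on `U(α) × U(α)`;
* (TRANSFER) `haar_prod_robustPairEvent_transfer`: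
  `Haar²{(V₁,V₂) : ∃L, rank L ≤ k, Σ|[M₁V₁,M₂V₂] − L|² ≤ s} ≤ Haar²{(P₁,P₂) : ∃L′, rank L′ ≤ k + 2(q₁+q₂), Σ|[P₁,P₂] − L′|² ≤ 2s + 24(ε₁²+ε₂²+ε₁²ε₂²)}`
  (outer-measure monotonicity through the measure-preserving map; no measurability of the events is needed).

So a blockwise d = 2 ROBUST pair small-ball bound (the planner's W0♯) applies to compressed links; this is the place where the
rank slack of (a♯) is spent («where ♯ pays»).  Also: Frobenius isometry of unitary multiplication (`sum_norm_sq_unitary_mul`,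
`sum_norm_sq_mul_unitary`) and the elementary `Σ|A+B|² ≤ 2(Σ|A|²+Σ|B|²)`, `Σ|A+B+C|² ≤ 3(…)`.

HONEST FRAMING: linear algebra + one invariance statement; no small-ball estimate is proved.  The route bears on the barrier-ledger
fact `EguchiKawaiBreakdown` only.
-/

set_option autoImplicit false

noncomputable section

open MeasureTheory
open scoped Matrix ENNReal
open Literature.Barriers.QuantumFields

namespace Summit.QuantumFields.YangMills.Theorems.EguchiKawaiDirectionLadder

variable {α : Type} [Fintype α] [DecidableEq α]

/-! ### §1 Frobenius bookkeeping: unitary isometry, sums -/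

omit [DecidableEq α] in
/-- `Σ|A_{ij}|² = Re tr(A A†)` (from `trace_mul_conjTranspose_eq_sum`). -/
theorem sum_norm_sq_eq_re_trace (A : Matrix α α ℂ) : ∑ i, ∑ j, ‖A i j‖ ^ 2 = (Matrix.trace (A * Aᴴ)).re := by
  rw [trace_mul_conjTranspose_eq_sum, Complex.ofReal_re]

/-- **Left unitary multiplication is a Frobenius isometry**: `Σ|(U S)_{ij}|² = Σ|S_{ij}|²`. -/
theorem sum_norm_sq_unitary_mul (U : Matrix.unitaryGroup α ℂ) (S : Matrix α α ℂ) :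
    ∑ i, ∑ j, ‖((U : Matrix α α ℂ) * S) i j‖ ^ 2 = ∑ i, ∑ j, ‖S i j‖ ^ 2 := by
  rw [sum_norm_sq_eq_re_trace, sum_norm_sq_eq_re_trace, Matrix.conjTranspose_mul]
  have h : (U : Matrix α α ℂ) * S * (Sᴴ * (U : Matrix α α ℂ)ᴴ) = (U : Matrix α α ℂ) * (S * Sᴴ) * star (U : Matrix α α ℂ) := by
    rw [Matrix.star_eq_conjTranspose]; noncomm_ring
  rw [h, Matrix.trace_mul_cycle, Matrix.UnitaryGroup.star_mul_self, Matrix.one_mul]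

/-- **Right unitary multiplication is a Frobenius isometry**: `Σ|(S U)_{ij}|² = Σ|S_{ij}|²`. -/
theorem sum_norm_sq_mul_unitary (S : Matrix α α ℂ) (U : Matrix.unitaryGroup α ℂ) :
    ∑ i, ∑ j, ‖(S * (U : Matrix α α ℂ)) i j‖ ^ 2 = ∑ i, ∑ j, ‖S i j‖ ^ 2 := by
  rw [sum_norm_sq_eq_re_trace, sum_norm_sq_eq_re_trace, Matrix.conjTranspose_mul]
  have hU : (U : Matrix α α ℂ) * (U : Matrix α α ℂ)ᴴ = 1 := by
    have h := Matrix.mem_unitaryGroup_iff.mp U.2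
    rwa [Matrix.star_eq_conjTranspose] at h
  have h : S * (U : Matrix α α ℂ) * ((U : Matrix α α ℂ)ᴴ * Sᴴ) = S * ((U : Matrix α α ℂ) * (U : Matrix α α ℂ)ᴴ) * Sᴴ := by
    noncomm_ring
  rw [h, hU, Matrix.mul_one]

omit [DecidableEq α] in
/-- `Σ|(A + B)_{ij}|² ≤ 2(Σ|A_{ij}|² + Σ|B_{ij}|²)`. -/
theorem sum_norm_sq_add_le (A B : Matrix α α ℂ) :
    ∑ i, ∑ j, ‖(A + B) i j‖ ^ 2 ≤ 2 * (∑ i, ∑ j, ‖A i j‖ ^ 2 + ∑ i, ∑ j, ‖B i j‖ ^ 2) := by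
  rw [mul_add, Finset.mul_sum, Finset.mul_sum, ← Finset.sum_add_distrib]
  refine Finset.sum_le_sum fun i _ => ?_
  rw [Finset.mul_sum, Finset.mul_sum, ← Finset.sum_add_distrib]
  refine Finset.sum_le_sum fun j _ => ?_
  have h := norm_add_le (A i j) (B i j)
  have ha := norm_nonneg (A i j)
  have hb := norm_nonneg (B i j)
  rw [Matrix.add_apply]
  nlinarith [sq_nonneg (‖A i j‖ - ‖B i j‖), norm_nonneg (A i j + B i j)]

omit [DecidableEq α] in
/-- `Σ|(A − B)_{ij}|² ≤ 2(Σ|A_{ij}|² + Σ|B_{ij}|²)`. -/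
theorem sum_norm_sq_sub_le (A B : Matrix α α ℂ) :
    ∑ i, ∑ j, ‖(A - B) i j‖ ^ 2 ≤ 2 * (∑ i, ∑ j, ‖A i j‖ ^ 2 + ∑ i, ∑ j, ‖B i j‖ ^ 2) := by
  have h := sum_norm_sq_add_le A (-B)
  simp only [Matrix.neg_apply, norm_neg] at h
  rwa [← sub_eq_add_neg] at h

omit [DecidableEq α] in
/-- `Σ|(A + B + C)_{ij}|² ≤ 3(Σ|A_{ij}|² + Σ|B_{ij}|² + Σ|C_{ij}|²)`. -/
theorem sum_norm_sq_add_three_le (A B C : Matrix α α ℂ) :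
    ∑ i, ∑ j, ‖(A + B + C) i j‖ ^ 2 ≤
      3 * (∑ i, ∑ j, ‖A i j‖ ^ 2 + ∑ i, ∑ j, ‖B i j‖ ^ 2 + ∑ i, ∑ j, ‖C i j‖ ^ 2) := by
  rw [mul_add, mul_add, Finset.mul_sum, Finset.mul_sum, Finset.mul_sum, ← Finset.sum_add_distrib,
    ← Finset.sum_add_distrib]
  refine Finset.sum_le_sum fun i _ => ?_
  rw [Finset.mul_sum, Finset.mul_sum, Finset.mul_sum, ← Finset.sum_add_distrib, ← Finset.sum_add_distrib]
  refine Finset.sum_le_sum fun j _ => ?_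
  have h1 := norm_add_le (A i j + B i j) (C i j)
  have h2 := norm_add_le (A i j) (B i j)
  have ha := norm_nonneg (A i j)
  have hb := norm_nonneg (B i j)
  have hc := norm_nonneg (C i j)
  rw [Matrix.add_apply, Matrix.add_apply]
  nlinarith [sq_nonneg (‖A i j‖ - ‖B i j‖), sq_nonneg (‖B i j‖ - ‖C i j‖), sq_nonneg (‖A i j‖ - ‖C i j‖),
    norm_nonneg (A i j + B i j + C i j), norm_nonneg (A i j + B i j)]

/-! ### §2 The commutator of defective links (algebra) -/

/-- **Commutator transfer, algebraic form.**  With `P_μ := Θ_μ V_μ` and `M_μ := Θ_μ + R_μ + S_μ`: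
`[M₁V₁, M₂V₂] = [P₁, P₂] + R′ + S′` where
`R′ = (R₁V₁)(M₂V₂) + (P₁ + S₁V₁)(R₂V₂) − (R₂V₂)(M₁V₁) − (P₂ + S₂V₂)(R₁V₁)` (every term has a factor `R_μ`) and
`S′ = P₁(S₂V₂) + (S₁V₁)P₂ + (S₁V₁)(S₂V₂) − (P₂(S₁V₁) + (S₂V₂)P₁ + (S₂V₂)(S₁V₁))`. -/
theorem commutator_transfer_identity (Θ₁ R₁ S₁ V₁ Θ₂ R₂ S₂ V₂ : Matrix α α ℂ) :
    (Θ₁ + R₁ + S₁) * V₁ * ((Θ₂ + R₂ + S₂) * V₂) - (Θ₂ + R₂ + S₂) * V₂ * ((Θ₁ + R₁ + S₁) * V₁) =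
      (Θ₁ * V₁ * (Θ₂ * V₂) - Θ₂ * V₂ * (Θ₁ * V₁)) +
      (R₁ * V₁ * ((Θ₂ + R₂ + S₂) * V₂) + (Θ₁ * V₁ + S₁ * V₁) * (R₂ * V₂) -
        R₂ * V₂ * ((Θ₁ + R₁ + S₁) * V₁) - (Θ₂ * V₂ + S₂ * V₂) * (R₁ * V₁)) +
      ((Θ₁ * V₁ * (S₂ * V₂) + S₁ * V₁ * (Θ₂ * V₂) + S₁ * V₁ * (S₂ * V₂)) -
        (Θ₂ * V₂ * (S₁ * V₁) + S₂ * V₂ * (Θ₁ * V₁) + S₂ * V₂ * (S₁ * V₁))) := by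
  noncomm_ring

omit [DecidableEq α] in
/-- The rank of the `R′` part is at most `2(q₁ + q₂)`. -/
theorem rank_transfer_R_le (Θ₁ R₁ S₁ V₁ Θ₂ R₂ S₂ V₂ : Matrix α α ℂ) :
    (R₁ * V₁ * ((Θ₂ + R₂ + S₂) * V₂) + (Θ₁ * V₁ + S₁ * V₁) * (R₂ * V₂) -
        R₂ * V₂ * ((Θ₁ + R₁ + S₁) * V₁) - (Θ₂ * V₂ + S₂ * V₂) * (R₁ * V₁)).rank ≤
      2 * (R₁.rank + R₂.rank) := by
  have h1 : (R₁ * V₁ * ((Θ₂ + R₂ + S₂) * V₂)).rank ≤ R₁.rank :=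
    (Matrix.rank_mul_le_left _ _).trans (Matrix.rank_mul_le_left _ _)
  have h2 : ((Θ₁ * V₁ + S₁ * V₁) * (R₂ * V₂)).rank ≤ R₂.rank :=
    (Matrix.rank_mul_le_right _ _).trans (Matrix.rank_mul_le_left _ _)
  have h3 : (R₂ * V₂ * ((Θ₁ + R₁ + S₁) * V₁)).rank ≤ R₂.rank :=
    (Matrix.rank_mul_le_left _ _).trans (Matrix.rank_mul_le_left _ _)
  have h4 : ((Θ₂ * V₂ + S₂ * V₂) * (R₁ * V₁)).rank ≤ R₁.rank :=
    (Matrix.rank_mul_le_right _ _).trans (Matrix.rank_mul_le_left _ _)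
  calc _ ≤ (R₁ * V₁ * ((Θ₂ + R₂ + S₂) * V₂) + (Θ₁ * V₁ + S₁ * V₁) * (R₂ * V₂) -
          R₂ * V₂ * ((Θ₁ + R₁ + S₁) * V₁)).rank + ((Θ₂ * V₂ + S₂ * V₂) * (R₁ * V₁)).rank := rank_sub_le _ _
    _ ≤ ((R₁ * V₁ * ((Θ₂ + R₂ + S₂) * V₂) + (Θ₁ * V₁ + S₁ * V₁) * (R₂ * V₂)).rank +
          (R₂ * V₂ * ((Θ₁ + R₁ + S₁) * V₁)).rank) + ((Θ₂ * V₂ + S₂ * V₂) * (R₁ * V₁)).rank := by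
        gcongr; exact rank_sub_le _ _
    _ ≤ ((R₁ * V₁ * ((Θ₂ + R₂ + S₂) * V₂)).rank + ((Θ₁ * V₁ + S₁ * V₁) * (R₂ * V₂)).rank +
          (R₂ * V₂ * ((Θ₁ + R₁ + S₁) * V₁)).rank) + ((Θ₂ * V₂ + S₂ * V₂) * (R₁ * V₁)).rank := by
        gcongr; exact rank_add_le _ _
    _ ≤ (R₁.rank + R₂.rank + R₂.rank) + R₁.rank := by gcongr
    _ = 2 * (R₁.rank + R₂.rank) := by ring

/-- The Frobenius mass of the `S′` part: `Σ|S′|² ≤ 12(ε₁² + ε₂² + ε₁²ε₂²)` when `Θ_μ, V_μ` are unitary and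
`Σ|S_μ|² ≤ ε_μ²`. -/
theorem sum_norm_sq_transfer_S_le (Θ₁ U₁ Θ₂ U₂ : Matrix.unitaryGroup α ℂ) (S₁ S₂ : Matrix α α ℂ) {e₁ e₂ : ℝ}
    (h₁ : ∑ i, ∑ j, ‖S₁ i j‖ ^ 2 ≤ e₁) (h₂ : ∑ i, ∑ j, ‖S₂ i j‖ ^ 2 ≤ e₂) :
    ∑ i, ∑ j, ‖(((Θ₁ : Matrix α α ℂ) * (U₁ : Matrix α α ℂ) * (S₂ * (U₂ : Matrix α α ℂ)) +
          S₁ * (U₁ : Matrix α α ℂ) * ((Θ₂ : Matrix α α ℂ) * (U₂ : Matrix α α ℂ)) +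
          S₁ * (U₁ : Matrix α α ℂ) * (S₂ * (U₂ : Matrix α α ℂ))) -
        ((Θ₂ : Matrix α α ℂ) * (U₂ : Matrix α α ℂ) * (S₁ * (U₁ : Matrix α α ℂ)) +
          S₂ * (U₂ : Matrix α α ℂ) * ((Θ₁ : Matrix α α ℂ) * (U₁ : Matrix α α ℂ)) +
          S₂ * (U₂ : Matrix α α ℂ) * (S₁ * (U₁ : Matrix α α ℂ)))) i j‖ ^ 2 ≤
      12 * (e₁ + e₂ + e₁ * e₂) := by
  set V₁ : Matrix α α ℂ := (U₁ : Matrix α α ℂ) with hV₁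
  set V₂ : Matrix α α ℂ := (U₂ : Matrix α α ℂ) with hV₂
  have he₁ : 0 ≤ e₁ := le_trans (Finset.sum_nonneg fun _ _ => Finset.sum_nonneg fun _ _ => by positivity) h₁
  have he₂ : 0 ≤ e₂ := le_trans (Finset.sum_nonneg fun _ _ => Finset.sum_nonneg fun _ _ => by positivity) h₂
  -- the six terms
  have t1 : ∑ i, ∑ j, ‖((Θ₁ : Matrix α α ℂ) * V₁ * (S₂ * V₂)) i j‖ ^ 2 ≤ e₂ := by
    have : (Θ₁ : Matrix α α ℂ) * V₁ * (S₂ * V₂) = ((Θ₁ * U₁ : Matrix.unitaryGroup α ℂ) : Matrix α α ℂ) * (S₂ * (U₂ : Matrix α α ℂ)) := by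
      rw [hV₁, hV₂, Matrix.UnitaryGroup.mul_val]
    rw [this, sum_norm_sq_unitary_mul, sum_norm_sq_mul_unitary]; exact h₂
  have t2 : ∑ i, ∑ j, ‖(S₁ * V₁ * ((Θ₂ : Matrix α α ℂ) * V₂)) i j‖ ^ 2 ≤ e₁ := by
    have : S₁ * V₁ * ((Θ₂ : Matrix α α ℂ) * V₂) = S₁ * ((U₁ * (Θ₂ * U₂) : Matrix.unitaryGroup α ℂ) : Matrix α α ℂ) := by
      rw [hV₁, hV₂, Matrix.UnitaryGroup.mul_val, Matrix.UnitaryGroup.mul_val, Matrix.mul_assoc]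
    rw [this, sum_norm_sq_mul_unitary]; exact h₁
  have t3 : ∑ i, ∑ j, ‖(S₁ * V₁ * (S₂ * V₂)) i j‖ ^ 2 ≤ e₁ * e₂ := by
    calc ∑ i, ∑ j, ‖(S₁ * V₁ * (S₂ * V₂)) i j‖ ^ 2
        ≤ (∑ i, ∑ j, ‖(S₁ * V₁) i j‖ ^ 2) * ∑ i, ∑ j, ‖(S₂ * V₂) i j‖ ^ 2 := sum_norm_sq_mul_le_mul _ _
      _ ≤ e₁ * e₂ := by
          rw [hV₁, hV₂, sum_norm_sq_mul_unitary, sum_norm_sq_mul_unitary]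
          exact mul_le_mul h₁ h₂ (Finset.sum_nonneg fun _ _ => Finset.sum_nonneg fun _ _ => by positivity) he₁
  have t4 : ∑ i, ∑ j, ‖((Θ₂ : Matrix α α ℂ) * V₂ * (S₁ * V₁)) i j‖ ^ 2 ≤ e₁ := by
    have : (Θ₂ : Matrix α α ℂ) * V₂ * (S₁ * V₁) = ((Θ₂ * U₂ : Matrix.unitaryGroup α ℂ) : Matrix α α ℂ) * (S₁ * (U₁ : Matrix α α ℂ)) := by
      rw [hV₁, hV₂, Matrix.UnitaryGroup.mul_val]
    rw [this, sum_norm_sq_unitary_mul, sum_norm_sq_mul_unitary]; exact h₁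
  have t5 : ∑ i, ∑ j, ‖(S₂ * V₂ * ((Θ₁ : Matrix α α ℂ) * V₁)) i j‖ ^ 2 ≤ e₂ := by
    have : S₂ * V₂ * ((Θ₁ : Matrix α α ℂ) * V₁) = S₂ * ((U₂ * (Θ₁ * U₁) : Matrix.unitaryGroup α ℂ) : Matrix α α ℂ) := by
      rw [hV₁, hV₂, Matrix.UnitaryGroup.mul_val, Matrix.UnitaryGroup.mul_val, Matrix.mul_assoc]
    rw [this, sum_norm_sq_mul_unitary]; exact h₂
  have t6 : ∑ i, ∑ j, ‖(S₂ * V₂ * (S₁ * V₁)) i j‖ ^ 2 ≤ e₁ * e₂ := by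
    calc ∑ i, ∑ j, ‖(S₂ * V₂ * (S₁ * V₁)) i j‖ ^ 2
        ≤ (∑ i, ∑ j, ‖(S₂ * V₂) i j‖ ^ 2) * ∑ i, ∑ j, ‖(S₁ * V₁) i j‖ ^ 2 := sum_norm_sq_mul_le_mul _ _
      _ ≤ e₂ * e₁ := by
          rw [hV₁, hV₂, sum_norm_sq_mul_unitary, sum_norm_sq_mul_unitary]
          exact mul_le_mul h₂ h₁ (Finset.sum_nonneg fun _ _ => Finset.sum_nonneg fun _ _ => by positivity) he₂
      _ = e₁ * e₂ := mul_comm _ _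
  have hX := sum_norm_sq_add_three_le ((Θ₁ : Matrix α α ℂ) * V₁ * (S₂ * V₂)) (S₁ * V₁ * ((Θ₂ : Matrix α α ℂ) * V₂))
    (S₁ * V₁ * (S₂ * V₂))
  have hY := sum_norm_sq_add_three_le ((Θ₂ : Matrix α α ℂ) * V₂ * (S₁ * V₁)) (S₂ * V₂ * ((Θ₁ : Matrix α α ℂ) * V₁))
    (S₂ * V₂ * (S₁ * V₁))
  have hXY := sum_norm_sq_sub_le
    ((Θ₁ : Matrix α α ℂ) * V₁ * (S₂ * V₂) + S₁ * V₁ * ((Θ₂ : Matrix α α ℂ) * V₂) + S₁ * V₁ * (S₂ * V₂))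
    ((Θ₂ : Matrix α α ℂ) * V₂ * (S₁ * V₁) + S₂ * V₂ * ((Θ₁ : Matrix α α ℂ) * V₁) + S₂ * V₂ * (S₁ * V₁))
  nlinarith

/-! ### §3 Measure: Haar pairs and the transfer -/

/-- Left multiplication by fixed unitaries, componentwise, preserves `Haar_{U(α)} ⊗ Haar_{U(α)}`. -/
theorem measurePreserving_unitary_mul_prod (Θ₁ Θ₂ : Matrix.unitaryGroup α ℂ) :
    MeasurePreserving (fun p : Matrix.unitaryGroup α ℂ × Matrix.unitaryGroup α ℂ => (Θ₁ * p.1, Θ₂ * p.2))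
      ((Literature.MathematicalPhysics.QuantumFieldTheory.haarProbability (Matrix.unitaryGroup α ℂ)).prod
        (Literature.MathematicalPhysics.QuantumFieldTheory.haarProbability (Matrix.unitaryGroup α ℂ)))
      ((Literature.MathematicalPhysics.QuantumFieldTheory.haarProbability (Matrix.unitaryGroup α ℂ)).prod
        (Literature.MathematicalPhysics.QuantumFieldTheory.haarProbability (Matrix.unitaryGroup α ℂ))) :=
  (measurePreserving_mul_left _ Θ₁).prod (measurePreserving_mul_left _ Θ₂)

/-- **ROBUST PAIR-EVENT TRANSFER.**  Let `Θ₁, Θ₂ ∈ U(α)`, `M_μ = Θ_μ + R_μ + S_μ` with `rank R_μ ≤ q_μ` and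
`Σ|S_μ|² ≤ ε_μ`.  Then for Haar-independent `V₁, V₂`:
`Haar²{(V₁,V₂) : ∃ L, rank L ≤ k ∧ Σ|M₁V₁M₂V₂ − M₂V₂M₁V₁ − L|² ≤ s}`
`≤ Haar²{(P₁,P₂) : ∃ L′, rank L′ ≤ k + 2(q₁+q₂) ∧ Σ|P₁P₂ − P₂P₁ − L′|² ≤ 2s + 24(ε₁ + ε₂ + ε₁ε₂)}`. -/
theorem haar_prod_robustPairEvent_transfer (Θ₁ Θ₂ : Matrix.unitaryGroup α ℂ) (R₁ S₁ R₂ S₂ : Matrix α α ℂ)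
    {q₁ q₂ k : ℕ} {e₁ e₂ s : ℝ} (hR₁ : R₁.rank ≤ q₁) (hR₂ : R₂.rank ≤ q₂)
    (hS₁ : ∑ i, ∑ j, ‖S₁ i j‖ ^ 2 ≤ e₁) (hS₂ : ∑ i, ∑ j, ‖S₂ i j‖ ^ 2 ≤ e₂) :
    (Literature.MathematicalPhysics.QuantumFieldTheory.haarProbability (Matrix.unitaryGroup α ℂ)).prod
        (Literature.MathematicalPhysics.QuantumFieldTheory.haarProbability (Matrix.unitaryGroup α ℂ))
      {V : Matrix.unitaryGroup α ℂ × Matrix.unitaryGroup α ℂ | ∃ L : Matrix α α ℂ, L.rank ≤ k ∧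
        ∑ i, ∑ j, ‖(((Θ₁ : Matrix α α ℂ) + R₁ + S₁) * (V.1 : Matrix α α ℂ) *
            (((Θ₂ : Matrix α α ℂ) + R₂ + S₂) * (V.2 : Matrix α α ℂ)) -
          ((Θ₂ : Matrix α α ℂ) + R₂ + S₂) * (V.2 : Matrix α α ℂ) *
            (((Θ₁ : Matrix α α ℂ) + R₁ + S₁) * (V.1 : Matrix α α ℂ)) - L) i j‖ ^ 2 ≤ s} ≤
    (Literature.MathematicalPhysics.QuantumFieldTheory.haarProbability (Matrix.unitaryGroup α ℂ)).prod
        (Literature.MathematicalPhysics.QuantumFieldTheory.haarProbability (Matrix.unitaryGroup α ℂ))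
      {P : Matrix.unitaryGroup α ℂ × Matrix.unitaryGroup α ℂ | ∃ L : Matrix α α ℂ, L.rank ≤ k + 2 * (q₁ + q₂) ∧
        ∑ i, ∑ j, ‖((P.1 : Matrix α α ℂ) * (P.2 : Matrix α α ℂ) - (P.2 : Matrix α α ℂ) * (P.1 : Matrix α α ℂ) - L) i j‖ ^ 2 ≤
          2 * s + 24 * (e₁ + e₂ + e₁ * e₂)} := by
  set μ := (Literature.MathematicalPhysics.QuantumFieldTheory.haarProbability (Matrix.unitaryGroup α ℂ)).prod
        (Literature.MathematicalPhysics.QuantumFieldTheory.haarProbability (Matrix.unitaryGroup α ℂ)) with hμ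
  set Φ := fun p : Matrix.unitaryGroup α ℂ × Matrix.unitaryGroup α ℂ => (Θ₁ * p.1, Θ₂ * p.2) with hΦ
  have hmp : MeasurePreserving Φ μ μ := measurePreserving_unitary_mul_prod Θ₁ Θ₂
  set E : Set (Matrix.unitaryGroup α ℂ × Matrix.unitaryGroup α ℂ) :=
      {V | ∃ L : Matrix α α ℂ, L.rank ≤ k ∧
        ∑ i, ∑ j, ‖(((Θ₁ : Matrix α α ℂ) + R₁ + S₁) * (V.1 : Matrix α α ℂ) *
            (((Θ₂ : Matrix α α ℂ) + R₂ + S₂) * (V.2 : Matrix α α ℂ)) -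
          ((Θ₂ : Matrix α α ℂ) + R₂ + S₂) * (V.2 : Matrix α α ℂ) *
            (((Θ₁ : Matrix α α ℂ) + R₁ + S₁) * (V.1 : Matrix α α ℂ)) - L) i j‖ ^ 2 ≤ s} with hE
  set F : Set (Matrix.unitaryGroup α ℂ × Matrix.unitaryGroup α ℂ) :=
      {P | ∃ L : Matrix α α ℂ, L.rank ≤ k + 2 * (q₁ + q₂) ∧
        ∑ i, ∑ j, ‖((P.1 : Matrix α α ℂ) * (P.2 : Matrix α α ℂ) - (P.2 : Matrix α α ℂ) * (P.1 : Matrix α α ℂ) - L) i j‖ ^ 2 ≤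
          2 * s + 24 * (e₁ + e₂ + e₁ * e₂)} with hF
  -- the event inclusion `E ⊆ Φ⁻¹ F`
  have hsub : E ⊆ Φ ⁻¹' F := by
    rintro ⟨U₁, U₂⟩ ⟨L, hLk, hLs⟩
    simp only [Set.mem_preimage, hF, Set.mem_setOf_eq, hΦ, Matrix.UnitaryGroup.mul_val]
    set V₁ : Matrix α α ℂ := (U₁ : Matrix α α ℂ) with hV₁
    set V₂ : Matrix α α ℂ := (U₂ : Matrix α α ℂ) with hV₂
    -- the pieces
    set Rp : Matrix α α ℂ := R₁ * V₁ * (((Θ₂ : Matrix α α ℂ) + R₂ + S₂) * V₂) +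
        ((Θ₁ : Matrix α α ℂ) * V₁ + S₁ * V₁) * (R₂ * V₂) -
        R₂ * V₂ * (((Θ₁ : Matrix α α ℂ) + R₁ + S₁) * V₁) - ((Θ₂ : Matrix α α ℂ) * V₂ + S₂ * V₂) * (R₁ * V₁) with hRp
    set Sp : Matrix α α ℂ := ((Θ₁ : Matrix α α ℂ) * V₁ * (S₂ * V₂) + S₁ * V₁ * ((Θ₂ : Matrix α α ℂ) * V₂) +
        S₁ * V₁ * (S₂ * V₂)) -
        ((Θ₂ : Matrix α α ℂ) * V₂ * (S₁ * V₁) + S₂ * V₂ * ((Θ₁ : Matrix α α ℂ) * V₁) + S₂ * V₂ * (S₁ * V₁)) with hSp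
    have hident := commutator_transfer_identity (Θ₁ : Matrix α α ℂ) R₁ S₁ V₁ (Θ₂ : Matrix α α ℂ) R₂ S₂ V₂
    have hRrank : Rp.rank ≤ 2 * (q₁ + q₂) :=
      (rank_transfer_R_le (Θ₁ : Matrix α α ℂ) R₁ S₁ V₁ (Θ₂ : Matrix α α ℂ) R₂ S₂ V₂).trans (by gcongr)
    have hSmass : ∑ i, ∑ j, ‖Sp i j‖ ^ 2 ≤ 12 * (e₁ + e₂ + e₁ * e₂) :=
      sum_norm_sq_transfer_S_le Θ₁ U₁ Θ₂ U₂ S₁ S₂ hS₁ hS₂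
    refine ⟨L - Rp, (rank_sub_le _ _).trans (by gcongr), ?_⟩
    -- `P₁P₂ − P₂P₁ − (L − R′) = (M₁V₁M₂V₂ − M₂V₂M₁V₁ − L) − S′`
    have hrew : (Θ₁ : Matrix α α ℂ) * V₁ * ((Θ₂ : Matrix α α ℂ) * V₂) -
        (Θ₂ : Matrix α α ℂ) * V₂ * ((Θ₁ : Matrix α α ℂ) * V₁) - (L - Rp) =
        (((Θ₁ : Matrix α α ℂ) + R₁ + S₁) * V₁ * (((Θ₂ : Matrix α α ℂ) + R₂ + S₂) * V₂) -
          ((Θ₂ : Matrix α α ℂ) + R₂ + S₂) * V₂ * (((Θ₁ : Matrix α α ℂ) + R₁ + S₁) * V₁) - L) - Sp := by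
      rw [hident, hRp, hSp]; abel
    rw [hrew]
    have h2 := sum_norm_sq_sub_le
      (((Θ₁ : Matrix α α ℂ) + R₁ + S₁) * V₁ * (((Θ₂ : Matrix α α ℂ) + R₂ + S₂) * V₂) -
          ((Θ₂ : Matrix α α ℂ) + R₂ + S₂) * V₂ * (((Θ₁ : Matrix α α ℂ) + R₁ + S₁) * V₁) - L) Sp
    linarith
  calc μ E ≤ μ (Φ ⁻¹' F) := measure_mono hsub
    _ ≤ μ.map Φ F := Measure.le_map_apply hmp.measurable.aemeasurable F
    _ = μ F := by rw [hmp.map_eq]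

end Summit.QuantumFields.YangMills.Theorems.EguchiKawaiDirectionLadder

end
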